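import Summits.Ventures.YMGap.RobustBall.ZNFluxWindowLayer
import HarnessLib

/-!
# RobustBall/ZNPoincare — the discrete Poincaré lemma on a torus box: a `ℤ/N` link field whose curl vanishes on every
# plaquette of a non-wrapping box is a gradient there

HONEST FRAMING: venture file of the cell `pub-ymgap` (track Y2 ROBUST-BALL, seat ds-4 g8): finite combinatorics on the
torus `(ℤ/L)^d`, no measure theory.  Infrastructure for the successor's step (P1) of HOME/ds/ds4/CENTRE-TUBE.md §5 («the
whole slab-local tier-1 ball around every centre-blind action lies in the windowed centre tube»): together with «a twist by
a gradient is a central gauge transformation» (`twistOf_grad_eq_gaugeTransform`) it shows that the twist defect of a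
gauge-invariant activity supported in a box depends on the twist only through its fluxes in the box.

THE LEMMA (`exists_potential_of_curl_free`).  Box with corner `c` and sides `n v < L` (so it does not wrap):
`Box c n = {x | ∀ v, val(x_v − c_v) < n_v}`.  If `k : links → ℤ/N` has `plaqSum k y w v = 0` for every plaquette whose four
corners lie in the box, then there is `θ : sites → ℤ/N` with `k(x, w) = θ(x + e_w) − θ(x)` for every link with both endpoints
in the box.  Proof: `θ(x) = ∑_v lineSum k v t_v(x) (P_v x)` along the lexicographic path from the corner (first direction `0`,
then `1`, …); the difference `θ(x + e_w) − θ(x)` telescopes by the strip identity `lineSum_shift_sub` (Stokes on a `1 × t`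
strip) and curl-freeness.
-/

noncomputable section

open Finset Function
open Literature.MathematicalPhysics.QuantumFieldTheory

namespace Summit.Ventures.YMGap.RobustBall

namespace ZNFluxW

open ZN

variable {d L N : ℕ} [NeZero L] [NeZero N]

/-! ### Strip Stokes -/

omit [NeZero L] [NeZero N] in
/-- `y + t e_v` as an iterated shift. [folklore] -/
theorem add_single_natCast_succ (y : Site d L) (v : Fin d) (t : ℕ) :
    y + Pi.single v (((t + 1 : ℕ) : ℕ) : ZMod L) = (y + Pi.single v ((t : ℕ) : ZMod L)).shift v := by
  simp only [Site.shift, Nat.cast_succ, Pi.single_add, add_assoc]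

omit [NeZero L] [NeZero N] in
/-- `lineSum` with the last step split off. [folklore] -/
theorem lineSum_succ_last (k : Edge d L → ZMod N) (v : Fin d) :
    ∀ (t : ℕ) (y : Site d L), lineSum k v (t + 1) y = lineSum k v t y + k (y + Pi.single v ((t : ℕ) : ZMod L), v)
  | 0, y => by simp [lineSum]
  | t + 1, y => by
      rw [lineSum, lineSum_succ_last k v t (y.shift v), lineSum, add_assoc]
      congr 2
      simp only [Site.shift, Nat.cast_succ, Pi.single_add]
      abel_nf

omit [NeZero L] [NeZero N] in
/-- **Stokes on a `1 × t` strip**: `lineSum k v t (y + e_w) − lineSum k v t y =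
k(y + t e_v, w) − k(y, w) + ∑_{s<t} plaqSum k (y + s e_v) w v`. [folklore] -/
theorem lineSum_shift_sub (k : Edge d L → ZMod N) (v w : Fin d) :
    ∀ (t : ℕ) (y : Site d L), lineSum k v t (y.shift w) - lineSum k v t y =
      k (y + Pi.single v ((t : ℕ) : ZMod L), w) - k (y, w) +
        ∑ s ∈ Finset.range t, plaqSum k (y + Pi.single v ((s : ℕ) : ZMod L)) w v
  | 0, y => by simp [lineSum]
  | t + 1, y => by
      rw [lineSum_succ_last, lineSum_succ_last, Finset.sum_range_succ, add_single_natCast_succ]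
      have ih := lineSum_shift_sub k v w t y
      have hsh : (y + Pi.single v ((t : ℕ) : ZMod L)).shift w = y.shift w + Pi.single v ((t : ℕ) : ZMod L) := by
        simp only [Site.shift]; abel
      rw [plaqSum, ← hsh]
      -- unfold the last plaquette: k(z,w) + k(z+e_w,v) - k(z+e_v,w) - k(z,v), z = y + t e_v
      linear_combination ih

/-! ### The box -/

/-- The non-wrapping box with corner `c` and sides `n`: offsets `val(x_v − c_v) < n_v`. [folklore] -/
def Box (c : Site d L) (n : Fin d → ℕ) (x : Site d L) : Prop := ∀ v, (x v - c v).val < n v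

/-- The offset of `x` from the corner in direction `v`. [folklore] -/
def off (c x : Site d L) (v : Fin d) : ℕ := (x v - c v).val

omit [NeZero N] in
/-- Across a box link the offset grows by one (no wrapping since `n w < L`). [folklore] -/
theorem off_shift_self {c : Site d L} {n : Fin d → ℕ} (hn : ∀ v, n v < L) {x : Site d L} (w : Fin d)
    (hx : Box c n x) : off c (x.shift w) w = off c x w + 1 := by
  unfold off
  have hlt : (x w - c w).val + 1 < L := by have := hx w; have := hn w; omega
  have hL : L ≠ 1 := by rintro rfl; have := hx w; have := hn w; omega
  have h1 : (1 : ZMod L).val = 1 := ZMod.val_one'' hL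
  rw [show (x.shift w) w - c w = (x w - c w) + 1 by simp [Site.shift]; ring,
    ZMod.val_add_of_lt (by rw [h1]; exact hlt), h1]

omit [NeZero L] [NeZero N] in
/-- Across a box link in another direction the offset is unchanged. [folklore] -/
theorem off_shift_of_ne (c x : Site d L) {v w : Fin d} (h : v ≠ w) : off c (x.shift w) v = off c x v := by
  unfold off; simp [Site.shift, Pi.single_eq_of_ne h]

/-! ### The lexicographic path and the potential -/

/-- The path vertex after the directions `< v` have been walked: coordinates `< v` from `x`, the rest from `c`. [folklore] -/
def pathPt (c x : Site d L) (v : ℕ) : Site d L := fun u => if (u : ℕ) < v then x u else c u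

omit [NeZero L] [NeZero N] in
/-- The path starts at the corner. [folklore] -/
theorem pathPt_zero (c x : Site d L) : pathPt c x 0 = c := by
  funext u; simp [pathPt]

omit [NeZero L] [NeZero N] in
/-- The path ends at `x`. [folklore] -/
theorem pathPt_of_le (c x : Site d L) {v : ℕ} (hv : d ≤ v) : pathPt c x v = x := by
  funext u; simp [pathPt, lt_of_lt_of_le u.2 hv]

omit [NeZero N] in
/-- One more direction: `P_{v+1} = P_v + t_v e_v`. [folklore] -/
theorem pathPt_succ (c x : Site d L) (v : Fin d) :
    pathPt c x (v + 1) = pathPt c x v + Pi.single v ((off c x v : ℕ) : ZMod L) := by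
  funext u
  by_cases huv : u = v
  · subst huv
    simp only [pathPt, Pi.add_apply, Pi.single_eq_same, off, ZMod.natCast_zmod_val, Nat.lt_succ_self, if_true,
      lt_irrefl, if_false]
    ring
  · have hne : (u : ℕ) ≠ v := fun h => huv (Fin.ext h)
    simp only [pathPt, Pi.add_apply, Pi.single_eq_of_ne huv, add_zero]
    by_cases hlt : (u : ℕ) < v
    · simp [hlt, Nat.lt_succ_of_lt hlt]
    · have : ¬(u : ℕ) < v + 1 := by omega
      simp [hlt, this]

omit [NeZero L] [NeZero N] in
/-- Shifting `x` in a direction `w ≥ v` does not move `P_v`. [folklore] -/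
theorem pathPt_shift_of_le (c x : Site d L) (w : Fin d) {v : ℕ} (h : v ≤ w) : pathPt c (x.shift w) v = pathPt c x v := by
  funext u
  by_cases hlt : (u : ℕ) < v
  · have huw : u ≠ w := fun he => by subst he; omega
    simp [pathPt, hlt, Site.shift, Pi.single_eq_of_ne huw]
  · simp [pathPt, hlt]

omit [NeZero L] [NeZero N] in
/-- Shifting `x` in a direction `w < v` shifts `P_v`. [folklore] -/
theorem pathPt_shift_of_lt (c x : Site d L) (w : Fin d) {v : ℕ} (h : (w : ℕ) < v) :
    pathPt c (x.shift w) v = (pathPt c x v).shift w := by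
  funext u
  by_cases huw : u = w
  · subst huw; simp [pathPt, h, Site.shift]
  · by_cases hlt : (u : ℕ) < v
    · simp [pathPt, hlt, Site.shift, Pi.single_eq_of_ne huw]
    · simp [pathPt, hlt, Site.shift, Pi.single_eq_of_ne huw]

/-- The potential: `θ(x) = ∑_v lineSum k v t_v(x) (P_v x)` along the lexicographic path from the corner. [folklore] -/
def potential (k : Edge d L → ZMod N) (c x : Site d L) : ZMod N :=
  ∑ v : Fin d, lineSum k v (off c x v) (pathPt c x v)

/-! ### Box membership of the strip plaquettes -/

omit [NeZero L] [NeZero N] in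
/-- Points `P_v + s e_v`, `s ≤ t_v(x)`, of the path lie in the box. [folklore] -/
theorem box_pathPt_add {c : Site d L} {n : Fin d → ℕ} (hn : ∀ v, n v < L) {x : Site d L} (hx : Box c n x) (v : Fin d)
    {s : ℕ} (hs : s ≤ off c x v) : Box c n (pathPt c x v + Pi.single v ((s : ℕ) : ZMod L)) := by
  intro u
  by_cases huv : u = v
  · subst huv
    have hsv : s < n u := lt_of_le_of_lt hs (hx u)
    simp only [Pi.add_apply, pathPt, lt_irrefl, if_false, Pi.single_eq_same, add_sub_cancel_left]
    rw [ZMod.val_natCast_of_lt (hsv.trans (hn u))]; exact hsv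
  · simp only [Pi.add_apply, Pi.single_eq_of_ne huv, add_zero, pathPt]
    split_ifs
    · exact hx u
    · simp only [sub_self, ZMod.val_zero]; exact Nat.pos_of_ne_zero fun h => by have := hx u; omega

omit [NeZero L] [NeZero N] in
/-- The same points shifted by `e_w`, `w < v`, lie in the box when `x + e_w` does. [folklore] -/
theorem box_pathPt_add_shift {c : Site d L} {n : Fin d → ℕ} (hn : ∀ v, n v < L) {x : Site d L}
    {w v : Fin d} (hxw : Box c n (x.shift w)) (hwv : (w : ℕ) < v) {s : ℕ} (hs : s ≤ off c x v) :
    Box c n ((pathPt c x v + Pi.single v ((s : ℕ) : ZMod L)).shift w) := by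
  have hwv' : w ≠ v := fun h => by subst h; exact lt_irrefl _ hwv
  have key : (pathPt c x v + Pi.single v ((s : ℕ) : ZMod L)).shift w =
      pathPt c (x.shift w) v + Pi.single v ((s : ℕ) : ZMod L) := by
    rw [pathPt_shift_of_lt c x w hwv]; simp only [Site.shift]; abel
  rw [key]
  exact box_pathPt_add hn hxw v (by rwa [off_shift_of_ne c x hwv'.symm])

/-! ### The telescoping sum -/

omit [NeZero L] [NeZero N] in
/-- Telescoping over an interval. [folklore] -/
theorem sum_Ico_sub_telescope {M : Type*} [AddCommGroup M] (g : ℕ → M) {a b : ℕ} (hab : a ≤ b) :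
    ∑ m ∈ Finset.Ico a b, (g (m + 1) - g m) = g b - g a := by
  induction b, hab using Nat.le_induction with
  | base => simp
  | succ b hab ih => rw [Finset.sum_Ico_succ_top hab, ih]; abel

omit [NeZero N] in
/-- **THE DISCRETE POINCARÉ LEMMA ON A BOX.**  Box with sides `n v < L`; `k` curl-free on every plaquette with its four
corners in the box ⇒ `k(x, w) = θ(x + e_w) − θ(x)` across every box link, with `θ = potential k c`. [folklore] -/
theorem potential_shift_sub {c : Site d L} {n : Fin d → ℕ} (hn : ∀ v, n v < L) (k : Edge d L → ZMod N)
    (hcurl : ∀ (y : Site d L) (w v : Fin d), w ≠ v → Box c n y → Box c n (y.shift w) → Box c n (y.shift v) →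
      Box c n ((y.shift v).shift w) → plaqSum k y w v = 0)
    {x : Site d L} (w : Fin d) (hx : Box c n x) (hxw : Box c n (x.shift w)) :
    potential k c (x.shift w) - potential k c x = k (x, w) := by
  classical
  unfold potential
  rw [← Finset.sum_sub_distrib]
  -- the summand: zero below `w`, the last step at `w`, a telescoping difference above `w`
  set g : ℕ → ZMod N := fun m => k (pathPt c x m, w) with hg
  have hterm : ∀ v : Fin d, lineSum k v (off c (x.shift w) v) (pathPt c (x.shift w) v) -
      lineSum k v (off c x v) (pathPt c x v) =
        if (v : ℕ) < w then 0 else if v = w then g (w + 1) else g (v + 1) - g v := by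
    intro v
    by_cases hvw : (v : ℕ) < w
    · have hne : v ≠ w := fun h => by subst h; exact lt_irrefl _ hvw
      rw [if_pos hvw, off_shift_of_ne c x hne, pathPt_shift_of_le c x w hvw.le, sub_self]
    rw [if_neg hvw]
    by_cases heq : v = w
    · subst heq
      rw [if_pos rfl, off_shift_self hn v hx, pathPt_shift_of_le c x v le_rfl, lineSum_succ_last, add_sub_cancel_left,
        hg]
      simp only [pathPt_succ]
    · have hwv : (w : ℕ) < v := lt_of_le_of_ne (not_lt.1 hvw) fun h => heq (Fin.ext h).symm
      rw [if_neg heq, off_shift_of_ne c x heq, pathPt_shift_of_lt c x w hwv, lineSum_shift_sub]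
      have hzero : ∑ s ∈ Finset.range (off c x v), plaqSum k (pathPt c x v + Pi.single v ((s : ℕ) : ZMod L)) w v = 0 := by
        refine Finset.sum_eq_zero fun s hs => ?_
        have hs' : s < off c x v := Finset.mem_range.1 hs
        have hwv' : w ≠ v := fun h => heq h.symm
        refine hcurl _ w v hwv' (box_pathPt_add hn hx v hs'.le) (box_pathPt_add_shift hn hxw hwv hs'.le) ?_ ?_
        · have e : (pathPt c x v + Pi.single v ((s : ℕ) : ZMod L)).shift v =
              pathPt c x v + Pi.single v (((s + 1 : ℕ) : ℕ) : ZMod L) := (add_single_natCast_succ (pathPt c x v) v s).symm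
          rw [e]; exact box_pathPt_add hn hx v hs'
        · have e : (pathPt c x v + Pi.single v ((s : ℕ) : ZMod L)).shift v =
              pathPt c x v + Pi.single v (((s + 1 : ℕ) : ℕ) : ZMod L) := (add_single_natCast_succ (pathPt c x v) v s).symm
          rw [e]; exact box_pathPt_add_shift hn hxw hwv hs'
      rw [hzero, add_zero, hg]
      simp only [pathPt_succ]
  rw [Finset.sum_congr rfl fun v _ => hterm v]
  -- pass to a sum over `range d` and telescope
  rw [Finset.sum_fin_eq_sum_range]
  have hsplit : ∑ m ∈ Finset.range d, (if h : m < d then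
      (if ((⟨m, h⟩ : Fin d) : ℕ) < w then (0 : ZMod N) else if (⟨m, h⟩ : Fin d) = w then g (w + 1) else g (m + 1) - g m)
      else 0) = ∑ m ∈ Finset.range d, (if m < w then 0 else if m = w then g (w + 1) else g (m + 1) - g m) := by
    refine Finset.sum_congr rfl fun m hm => ?_
    rw [dif_pos (Finset.mem_range.1 hm)]
    simp only [Fin.ext_iff]
  rw [hsplit]
  have hw : (w : ℕ) < d := w.2
  rw [Finset.range_eq_Ico, ← Finset.sum_Ico_consecutive _ (Nat.zero_le (w : ℕ)) hw.le,
    ← Finset.sum_Ico_consecutive _ (Nat.le_succ (w : ℕ)) (Nat.succ_le_of_lt hw), Nat.Ico_succ_singleton,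
    Finset.sum_singleton]
  have h1 : ∑ i ∈ Finset.Ico 0 (w : ℕ), (if i < (w : ℕ) then (0 : ZMod N) else if i = w then g (w + 1) else g (i + 1) - g i) = 0 :=
    Finset.sum_eq_zero fun i hi => by rw [Finset.mem_Ico] at hi; rw [if_pos hi.2]
  have h2 : (if (w : ℕ) < (w : ℕ) then (0 : ZMod N) else if (w : ℕ) = w then g (w + 1) else g (w + 1) - g w) = g (w + 1) := by
    rw [if_neg (lt_irrefl _), if_pos rfl]
  have h3 : ∑ i ∈ Finset.Ico ((w : ℕ) + 1) d, (if i < (w : ℕ) then (0 : ZMod N) else if i = w then g (w + 1) else g (i + 1) - g i) =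
      g d - g (w + 1) := by
    rw [← sum_Ico_sub_telescope g (Nat.succ_le_of_lt hw)]
    refine Finset.sum_congr rfl fun i hi => ?_
    rw [Finset.mem_Ico] at hi
    rw [if_neg (by omega), if_neg (by omega)]
  rw [h1, h2, h3, zero_add, add_sub_cancel, hg]
  simp only [pathPt_of_le c x le_rfl]

/-! ### Twists by gradients are central gauge transformations -/

/-- The discrete gradient of a site function. [folklore] -/
def grad (θ : Site d L → ZMod N) (e : Edge d L) : ZMod N := θ (e.1.shift e.2) - θ e.1

omit [NeZero L] in
/-- **A twist by a gradient is a gauge transformation by central elements**: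
`ζ_{dθ} · U = gaugeTransform (x ↦ centreOf(θ x)⁻¹) U`. [folklore] -/
theorem twistOf_grad_mul_eq_gaugeTransform (θ : Site d L → ZMod N) (U : GaugeConfig d L (SUN N)) :
    twistOf (grad θ) * U = gaugeTransform (fun x => (centreOf (θ x))⁻¹) U := by
  funext e
  simp only [Pi.mul_apply, twistOf, grad, gaugeTransform, inv_inv]
  have hc : U e * centreOf (θ (e.1.shift e.2)) = centreOf (θ (e.1.shift e.2)) * U e :=
    Subgroup.mem_center_iff.1 (centreOf_mem_center _) (U e)
  rw [mul_assoc, hc, ← mul_assoc, ← centreOf_neg, ← centreOf_add, sub_eq_neg_add]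

omit [NeZero L] in
/-- Gauge-invariant functions are blind to gradient twists. [folklore] -/
theorem apply_twistOf_grad_mul {α : Type*} {V : GaugeConfig d L (SUN N) → α} (hV : IsGaugeInvariant V)
    (θ : Site d L → ZMod N) (U : GaugeConfig d L (SUN N)) : V (twistOf (grad θ) * U) = V U := by
  rw [twistOf_grad_mul_eq_gaugeTransform]; exact hV _ U

omit [NeZero L] [NeZero N] in
/-- `plaqSum` is additive in the link field. [folklore] -/
theorem plaqSum_sub (k k' : Edge d L → ZMod N) (y : Site d L) (w v : Fin d) :
    plaqSum (k - k') y w v = plaqSum k y w v - plaqSum k' y w v := by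
  simp only [plaqSum, Pi.sub_apply]; ring

/-- **THE TWIST DEFECT OF A GAUGE-INVARIANT BOX-SUPPORTED FUNCTION DEPENDS ONLY ON THE FLUXES IN THE BOX**: if `V` is gauge
invariant and reads only links with both endpoints in a non-wrapping box, and two twists `k, k'` have the same curl on every
plaquette of the box, then `V(ζ_k · U) = V(ζ_{k'} · U)`. [folklore] -/
theorem apply_twistOf_mul_eq_of_plaqSum_eq {α : Type*} {c : Site d L} {n : Fin d → ℕ} (hn : ∀ v, n v < L)
    {V : GaugeConfig d L (SUN N) → α} (hV : IsGaugeInvariant V) {E : Set (Edge d L)} (hdep : DependsOn V E)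
    (hE : ∀ e ∈ E, Box c n e.1 ∧ Box c n (e.1.shift e.2)) {k k' : Edge d L → ZMod N}
    (hcurl : ∀ (y : Site d L) (w v : Fin d), w ≠ v → Box c n y → Box c n (y.shift w) → Box c n (y.shift v) →
      Box c n ((y.shift v).shift w) → plaqSum k y w v = plaqSum k' y w v)
    (U : GaugeConfig d L (SUN N)) : V (twistOf k * U) = V (twistOf k' * U) := by
  set θ := potential (k - k') c with hθ
  have hpot : ∀ e ∈ E, (k - k') e = grad θ e := by
    rintro ⟨x, w⟩ he
    obtain ⟨hx, hxw⟩ := hE _ he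
    rw [grad, hθ, potential_shift_sub hn (k - k') (fun y w' v hwv hy hyw hyv hyvw => by
      rw [plaqSum_sub, hcurl y w' v hwv hy hyw hyv hyvw, sub_self]) w hx hxw]
  have hagree : ∀ e ∈ E, (twistOf k * U) e = (twistOf (grad θ) * (twistOf k' * U)) e := by
    intro e he
    simp only [Pi.mul_apply, twistOf, ← hpot e he, Pi.sub_apply, ← mul_assoc, ← centreOf_add, sub_add_cancel]
  rw [hdep hagree, apply_twistOf_grad_mul hV]

end ZNFluxW

end Summit.Ventures.YMGap.RobustBall

end
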